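import Summits.QuantumFields.YangMills.Theorems.UnitScaleTiltFluctuationComparisonRegPrGlobalSlackLegOldTermsKernelForm
import Summits.QuantumFields.YangMills.Theorems.UnitScaleTiltFluctuationComparisonRegPrGlobalSlackKernelLegAnalyticOwnV4
import HarnessLib

/-!
# `UnitScaleTiltFluctuationComparisonRegPrGlobalSlackLegOldTermsKernelFormAnalytic` — THE OWN-INDEXED ANALYTICITY ROW (R2′) OF THE NATURAL CHART FAMILY `Φ♮[Φ₀, N]` SPLITS INTO THE
# BACKGROUND FAMILY'S ROW OFF THE BLOCKS AND A LEG-WEIGHTED KERNEL BUDGET ON THE BLOCKS; THE GEOMETRIC LETTER `hsep` FROM `L < M₁` (crux `FluctuationComparisonRegPrIntL`, stmt-QuantumFields-20520, STUB 3⁗χ(v4); cell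
# `pub/ym-inputs`, seat ym-inputs-p11 (g2); count-neutral helper, def-free, registry untouched)

WHY.  `…LegOldTermsKernelForm` (this seat) builds the natural chart family `Φ♮[Φ₀, N]` (print's (43) kernel polynomials `P_{N K b y}` on the old blocks `blockSet K (1+b) y`, a background
family `Φ₀` — at the door `birthChartRows q` — on every other point set) and proves the (R2′) clause of ONE leg-rescaled kernel polynomial from its leg-weighted kernel budget
(✓`chartAnalyticityAsCited_rescaleW_naturalChart_blockSet`).  The door's analyticity row is the own-indexed schema `ChartAnalyticOwnΦ D (rescaleΦw dist κ′ Φ) κ ρ C_A` (✓`…KernelLegAnalyticOwn`: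
every LISTED domain `Y ∈ D.Loc K k triv (1+b)` carries `ChartAnalyticityAsCited (Φ K b Y ∘ D_w) ρ (C_A·e^{−κ𝓛_K(1+b,Y)})`; the two-clause row of record follows by ✓`chartAnalyticΦ_of_own` /
✓`chartAnalyticLegΦ_chiV4_of_own`).  For `Φ := Φ♮[Φ₀, N]` that row SPLITS along the case distinction in `Φ♮`'s definition:

* ★ **`chartAnalyticOwnΦ_rescaleW_naturalChart`** — for ANY datum `D` whose listed term levels are lattice levels (`hLoc`: `Y ∈ D.Loc K k triv (1+b) → 1 + b ≤ m + K`, true for the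
  canonical polymerisations), `ChartAnalyticOwnΦ D (rescaleΦw dist κ′ Φ♮[Φ₀,N]) κ ρ C_A` follows from (a) the SAME row for the background family `Φ₀` at the listed point sets that are
  NOT blocks (at the door: the birth charts on the retained domains — the (α)-record desk's localisation display, ✓p623174's brick) and (b) print's (43) decay as a LEG-WEIGHTED KERNEL
  BUDGET at every listed block: `Σ_{n∈[2,7)} (n!)⁻¹ Σ_c ‖N K b y n c‖·(Πᵢ e^{κ′·dist(cᵢ)})·(ρ/2)ⁿ ≤ C_A·e^{−κ𝓛_K(1+b, blockSet y)}`.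
* ★ **`blockSet_ne_domSet_of_lt`**, **`hsep_of_lt`** (§3) — the geometric letter `hsep` of the natural chart family («no retained step-`k` domain has the point set of a level-`(k+1)`
  block») DISCHARGED from `L < M₁` by counting fine sites (a big block carries `M₁³(Lᵏ)³ > L³(Lᵏ)³` of them; on a small torus the domain's point set is everything and a block is not).
* `one_add_le_of_mem_canonLocRows` — `hLoc` for the canonical rows polymerisation `canonLocRows q` (listed term levels at lattice level `k ≤ K` are `≤ k`; above the top only `univ` at
  term level `1`), so that at the v4 χ-datum `dataOfV4chi p (canonPolymerRows (toRows ∘ p))` the split holds with `hLoc` discharged: **`chartAnalyticOwnΦ_rescaleW_naturalChart_rows`**.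

HONEST SCOPE.  Case bookkeeping over the two landed lemmas; both halves (a) and (b) stay HYPOTHESES (the background charts' analyticity is a display of the (α) record; the kernel budget
is the definer's reading of (43)); nothing of [Balaban1985UV3] / [King1986] asserted; no summit / rung / gap claim (YM₃ on T³ is ladder rung R3, not the Clay problem).  L-floor: none.

References: T. Bałaban, CMP 102 (1985) 255–275 [Balaban1985UV3] ((25) p.262, (29)–(30) p.263, (33)–(34) p.264, (43)–(45) pp.266–267); C. King, CMP 102 (1986) 649–677 [King1986]
((3.55) p.662).
-/

set_option autoImplicit false

noncomputable section

open scoped BigOperators Nat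
open Metric Finset
open Literature.MathematicalPhysics.QuantumFieldTheory.Balaban1983to89
open Literature.MathematicalPhysics.QuantumFieldTheory.Balaban1983to89.T3ContinuumYM3Torus
open Literature.MathematicalPhysics.QuantumFieldTheory.Balaban1983to89.T3AlphaInputsAC (AlphaDataT3)
open Literature.MathematicalPhysics.QuantumFieldTheory.Balaban1985CMP102
open Literature.MathematicalPhysics.QuantumFieldTheory.Balaban1985CMP102.Setting
open Literature.MathematicalPhysics.QuantumFieldTheory.Balaban1985CMP102.Binders (ChartAnalyticityAsCited)
open Summit.QuantumFields.Balaban3D.Carriers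
open Summit.QuantumFields.Balaban3D.Proofs.Primitives
open Summit.QuantumFields.Balaban3D.Proofs.GroupModelLieC (lieC)
open Summit.QuantumFields.YangMills.Theorems
open Summit.QuantumFields.YangMills.Theorems.GlobalSlackKernelMatching
open Summit.QuantumFields.YangMills.Theorems.GlobalSlackCanonicalPolymers
open Literature.MathematicalPhysics.QuantumFieldTheory.Balaban1983to89.TreeLengthTorus (tsys)

namespace Summit.QuantumFields.YangMills.Theorems.GlobalSlackKernelLeg

/-! ## §1 The split of the own-indexed analyticity row for `Φ♮[Φ₀, N]` over any datum -/

section Split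

variable {F : T3Family} {γ : ℝ} {𝕍 : Type} [NormedAddCommGroup 𝕍] [NormedSpace ℂ 𝕍]
  (Φ₀ : ChartFam 𝕍 F)
  (N : (K b : ℕ) → Site (F.P K) (1 + b) → (n : ℕ) → (Fin n → PBond (F.P K) b) → ContinuousMultilinearMap ℂ (fun _ : Fin n => 𝕍) ℂ)

open Classical in
/-- ★ **THE OWN-INDEXED ANALYTICITY ROW OF THE LEG-RESCALED NATURAL CHART FAMILY SPLITS**: over any datum `D` whose listed term levels are lattice levels (`hLoc`), the background family's
row at the listed NON-block point sets (`hbg`) and the leg-weighted kernel budget at the listed blocks (`hker`) give `ChartAnalyticOwnΦ D (rescaleΦw dist κ′ Φ♮[Φ₀,N]) κ ρ C_A`.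
[cite: Balaban1985UV3, (25) p.262, (43) p.266, (45) p.267; King1986, (3.55) p.662] -/
theorem chartAnalyticOwnΦ_rescaleW_naturalChart (D : AlphaDataT3 F γ) (dist : LegDist F) {κ' κ ρ C_A : ℝ} (hρ : 0 < ρ)
    (hLoc : ∀ (K k b : ℕ) (Y : Set (Site (F.P K) 0)), Y ∈ D.Loc K k (D.triv K k) (1 + b) → 1 + b ≤ F.m + K)
    (hbg : ∀ (K k b : ℕ) (Y : Set (Site (F.P K) 0)), Y ∈ D.Loc K k (D.triv K k) (1 + b) → (∀ y : Site (F.P K) (1 + b), blockSet K (1 + b) y ≠ Y) →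
      ChartAnalyticityAsCited (rescaleΦw dist κ' Φ₀ K b Y) ρ (C_A * Real.exp (-κ * D.treeLen K (1 + b) Y)))
    (hker : ∀ (K k b : ℕ) (y : Site (F.P K) (1 + b)), blockSet K (1 + b) y ∈ D.Loc K k (D.triv K k) (1 + b) →
      ∑ n ∈ Finset.Ico 2 7, ((n ! : ℝ))⁻¹ * ∑ c : Fin n → PBond (F.P K) b,
        ‖N K b y n c‖ * (∏ i, Real.exp (κ' * dist K b (blockSet K (1 + b) y) (c i))) * (ρ / 2) ^ n ≤
          C_A * Real.exp (-κ * D.treeLen K (1 + b) (blockSet K (1 + b) y))) :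
    ChartAnalyticOwnΦ D (rescaleΦw dist κ' (fun K b Y =>
        if h : ∃ y : Site (F.P K) (1 + b), blockSet K (1 + b) y = Y then
          (fun x : PBond (F.P K) b → 𝕍 => ∑ n ∈ Finset.Ico 2 7, ((n ! : ℂ))⁻¹ * ∑ c : Fin n → PBond (F.P K) b, N K b h.choose n c (fun i => x (c i)))
        else Φ₀ K b Y : ChartFam 𝕍 F)) κ ρ C_A := by
  intro K k b Y hY
  by_cases hblk : ∃ y : Site (F.P K) (1 + b), blockSet K (1 + b) y = Y
  · obtain ⟨y, rfl⟩ := hblk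
    exact chartAnalyticityAsCited_rescaleW_naturalChart_blockSet Φ₀ N dist κ' (hLoc K k b _ hY) y hρ (hker K k b y hY)
  · have hne : ∀ y : Site (F.P K) (1 + b), blockSet K (1 + b) y ≠ Y := fun y hy => hblk ⟨y, hy⟩
    have hfun : rescaleΦw dist κ' (fun K b Y =>
        if h : ∃ y : Site (F.P K) (1 + b), blockSet K (1 + b) y = Y then
          (fun x : PBond (F.P K) b → 𝕍 => ∑ n ∈ Finset.Ico 2 7, ((n ! : ℂ))⁻¹ * ∑ c : Fin n → PBond (F.P K) b, N K b h.choose n c (fun i => x (c i)))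
        else Φ₀ K b Y : ChartFam 𝕍 F) K b Y = rescaleΦw dist κ' Φ₀ K b Y := by
      funext z
      exact congrFun (naturalChart_of_forall_ne Φ₀ N hne) (legD 𝕍 dist κ' K b Y z)
    rw [hfun]
    exact hbg K k b Y hY hne

end Split

/-! ## §2 The listed term levels of the canonical rows polymerisation are lattice levels -/

section Rows

variable {F : T3Family} {𝔠 : AlphaConsts F.L (suGroupModel 2).N} {γ : ℝ} {hγ : 0 < γ} {hγ1 : γ ≤ (min 𝔠.gamma0 1) ^ 2}
  (q : ∀ K, AlphaInputsT3AC.PkgCoreRows F 𝔠 γ hγ hγ1 K)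

/-- **`hLoc` FOR `canonLocRows q`**: a listed point set of term level `1 + b` at lattice level `k` (trivial history) has `1 + b ≤ m + K` (below the top the listed term levels are `≤ k ≤ K`;
above the top only term level `1` is listed; `1 ≤ m`). [cite: Balaban1985UV3, (43) p.266, (59) p.270] -/
theorem one_add_le_of_mem_canonLocRows {K k b : ℕ} {Y : Set (Site (F.P K) 0)} (hY : Y ∈ canonLocRows q K k (Hist.triv (F.P K) k) (1 + b)) : 1 + b ≤ F.m + K := by
  classical
  have hm := F.hm
  cases k with
  | zero => simp [canonLocRows] at hY
  | succ j =>
    by_cases hj : j + 1 ≤ K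
    · by_cases hi : 1 + b = j + 1
      · omega
      · by_cases hi' : 1 + b ∈ Finset.Icc 1 j
        · have := (Finset.mem_Icc.mp hi').2; omega
        · simp only [canonLocRows, if_pos hj, if_neg hi, if_neg hi'] at hY
          simp at hY
    · by_cases hi : 1 + b = 1
      · omega
      · simp only [canonLocRows, if_neg hj, if_neg hi] at hY
        simp at hY

variable (N : (K b : ℕ) → Site (F.P K) (1 + b) → (n : ℕ) → (Fin n → PBond (F.P K) b) → ContinuousMultilinearMap ℂ (fun _ : Fin n => ↥(lieC (suGroupModel 2))) ℂ)

open Classical in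
/-- ★ **THE SPLIT AT THE ROWS DATUM** `dataOfCoreRows q (canonPolymerRows q)` with `Φ₀ := birthChartRows q` (`hLoc` discharged by `one_add_le_of_mem_canonLocRows`): the own-indexed analyticity
row of `rescaleΦw dist κ′ Φ♮[birthChartRows q, N]` from the birth charts' row at the listed non-block point sets and the leg-weighted kernel budget at the listed blocks.  The v4 χ-package
instance is `q := fun K ↦ (p K).toRows` (datum `dataOfV4chi p (canonPolymerRows …)`, by `rfl`). [cite: Balaban1985UV3, (25) p.262, (33)-(34) p.264, (43) p.266; King1986, (3.55) p.662] -/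
theorem chartAnalyticOwnΦ_rescaleW_naturalChart_rows (dist : LegDist F) {κ' κ ρ C_A : ℝ} (hρ : 0 < ρ)
    (hbg : ∀ (K k b : ℕ) (Y : Set (Site (F.P K) 0)), Y ∈ canonLocRows q K k (Hist.triv (F.P K) k) (1 + b) → (∀ y : Site (F.P K) (1 + b), blockSet K (1 + b) y ≠ Y) →
      ChartAnalyticityAsCited (rescaleΦw dist κ' (birthChartRows q) K b Y) ρ
        (C_A * Real.exp (-κ * (AlphaInputsT3AC.dataOfCoreRows q (canonPolymerRows q)).treeLen K (1 + b) Y)))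
    (hker : ∀ (K k b : ℕ) (y : Site (F.P K) (1 + b)), blockSet K (1 + b) y ∈ canonLocRows q K k (Hist.triv (F.P K) k) (1 + b) →
      ∑ n ∈ Finset.Ico 2 7, ((n ! : ℝ))⁻¹ * ∑ c : Fin n → PBond (F.P K) b,
        ‖N K b y n c‖ * (∏ i, Real.exp (κ' * dist K b (blockSet K (1 + b) y) (c i))) * (ρ / 2) ^ n ≤
          C_A * Real.exp (-κ * (AlphaInputsT3AC.dataOfCoreRows q (canonPolymerRows q)).treeLen K (1 + b) (blockSet K (1 + b) y))) :
    ChartAnalyticOwnΦ (AlphaInputsT3AC.dataOfCoreRows q (canonPolymerRows q)) (rescaleΦw dist κ' (fun K b Y =>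
        if h : ∃ y : Site (F.P K) (1 + b), blockSet K (1 + b) y = Y then
          (fun x : PBond (F.P K) b → ↥(lieC (suGroupModel 2)) =>
            ∑ n ∈ Finset.Ico 2 7, ((n ! : ℂ))⁻¹ * ∑ c : Fin n → PBond (F.P K) b, N K b h.choose n c (fun i => x (c i)))
        else birthChartRows q K b Y)) κ ρ C_A :=
  chartAnalyticOwnΦ_rescaleW_naturalChart (birthChartRows q) N (AlphaInputsT3AC.dataOfCoreRows q (canonPolymerRows q)) dist hρ
    (fun _ _ _ _ hY => one_add_le_of_mem_canonLocRows q hY) hbg hker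

end Rows

/-! ## §3 The geometric letter `hsep` from `L < M₁`: no retained domain has the point set of a block one level up -/

section Separation

variable {F : T3Family} {𝔠 : AlphaConsts F.L (suGroupModel 2).N} {γ : ℝ} {hγ : 0 < γ} {hγ1 : γ ≤ (min 𝔠.gamma0 1) ^ 2}

/-- ★ **A STEP-`k` DOMAIN'S POINT SET IS NEVER A LEVEL-`(k+1)` BLOCK WHEN `L < M₁`** (`k + 1 ≤ K`): counting fine sites — if `M₁ ≤ S_k` the domain contains a whole big block of
`M₁³·(Lᵏ)³ > L³·(Lᵏ)³ = #block` fine sites; if `S_k < M₁` (one big block = the whole torus) the domain's point set is everything, while a level-`(k+1)` block is not (`S_{k+1} ≥ 2`).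
With `L ≤ M₁` only, equality forces a one-cube domain (✓`dj_eq_zero_of_domSet_eq_blockSet`); `L = M₁` is the one case print's «big blocks» (M₁ large) never meets.
[cite: Balaban1985UV3, (24) p.262, (39) p.266, (59) p.270] -/
theorem blockSet_ne_domSet_of_lt (hM : F.L < 𝔠.M₁) (K k : ℕ) (hk : k + 1 ≤ K)
    (X : (tsys 3 (nblkOf (SK F 𝔠 γ hγ hγ1 K) 𝔠.lane.carrier k)).Dom) {i : ℕ} (hi : i = k + 1) (y : Site (F.P K) i) :
    blockSet K i y ≠ domSet (F := F) 𝔠.lane.carrier.M₁ K k X := by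
  classical
  subst hi
  intro heq
  have hm := F.hm
  have hM0 : 0 < 𝔠.M₁ := 𝔠.M₁_pos
  have hPL : (F.P K).L = F.L := rfl
  obtain ⟨b, hb⟩ := X.2.1
  by_cases hcase : 𝔠.M₁ ≤ (F.P K).sitesPerDir k
  · -- no wrap-around: the big block `b` has `M₁³` level-`k` sites, all inside the domain's point set = the block
    have hN : nblkOf (SK F 𝔠 γ hγ hγ1 K) 𝔠.lane.carrier k = (F.P K).sitesPerDir k / 𝔠.M₁ := by
      rw [nblkOf_SK]; exact max_eq_right (Nat.div_pos hcase hM0)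
    have ht : ∀ μ, (b μ).val * 𝔠.M₁ + 𝔠.M₁ ≤ (F.P K).sitesPerDir k := fun μ => by
      have h1 : (b μ).val < (F.P K).sitesPerDir k / 𝔠.M₁ := lt_of_lt_of_eq (ZMod.val_lt (b μ)) hN
      calc (b μ).val * 𝔠.M₁ + 𝔠.M₁ = ((b μ).val + 1) * 𝔠.M₁ := by ring
        _ ≤ ((F.P K).sitesPerDir k / 𝔠.M₁) * 𝔠.M₁ := Nat.mul_le_mul_right _ h1
        _ ≤ (F.P K).sitesPerDir k := Nat.div_mul_le_self _ _
    set Z : Finset (Site (F.P K) k) := univ.image (offSite F K k 𝔠.M₁ (fun μ => (b μ).val) (w := 𝔠.M₁)) with hZ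
    have hZcard : Z.card = 𝔠.M₁ ^ 3 := by
      rw [hZ, card_image_of_injective _ (offSite_injective K k 𝔠.M₁ _ ht), card_univ, Fintype.card_fun, Fintype.card_fin, Fintype.card_fin]
    have hsub : (univ.filter fun x : Site (F.P K) 0 => coarsen k x ∈ Z) ⊆ univ.filter fun x => coarsen (k + 1) x = y := by
      intro x hx
      rw [mem_filter] at hx ⊢
      obtain ⟨r, -, hr⟩ := mem_image.mp hx.2
      refine ⟨hx.1, ?_⟩
      have hxdom : x ∈ domSet (F := F) 𝔠.lane.carrier.M₁ K k X := by
        simp only [domSet, Set.mem_setOf_eq]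
        refine ⟨b, hb, funext fun μ => ?_⟩
        show ((coarsen k x) μ).val / 𝔠.M₁ = (b μ).val
        rw [← hr]
        exact bigLabel_offSite K k 𝔠.M₁ hM0 _ r μ (ht μ)
      rw [← heq] at hxdom
      exact hxdom
    have hle : 𝔠.M₁ ^ 3 * ((F.P K).L ^ k) ^ 3 ≤ ((F.P K).L ^ (k + 1)) ^ 3 := by
      calc 𝔠.M₁ ^ 3 * ((F.P K).L ^ k) ^ 3 = (univ.filter fun x : Site (F.P K) 0 => coarsen k x ∈ Z).card := by
            rw [card_filter_coarsen_mem K k (by omega) Z, hZcard]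
        _ ≤ (univ.filter fun x : Site (F.P K) 0 => coarsen (k + 1) x = y).card := card_le_card hsub
        _ = ((F.P K).L ^ (k + 1)) ^ 3 := card_filter_coarsen K (k + 1) (by omega) y
    have hL0 : 0 < ((F.P K).L ^ k) ^ 3 := by rw [hPL]; have := F.hL.2; positivity
    have h3 : 𝔠.M₁ ^ 3 ≤ (F.P K).L ^ 3 := by
      have e : ((F.P K).L ^ (k + 1)) ^ 3 = (F.P K).L ^ 3 * ((F.P K).L ^ k) ^ 3 := by ring
      rw [e] at hle
      exact Nat.le_of_mul_le_mul_right hle hL0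
    have h1 : 𝔠.M₁ ≤ (F.P K).L := (Nat.pow_le_pow_iff_left (by norm_num)).mp h3
    rw [hPL] at h1
    omega
  · -- small torus: the domain's point set is the whole torus, a level-`(k+1)` block is not
    rw [not_le] at hcase
    have hN : nblkOf (SK F 𝔠 γ hγ hγ1 K) 𝔠.lane.carrier k = 1 := by rw [nblkOf_SK, Nat.div_eq_of_lt hcase]; rfl
    have huniv : ∀ x : Site (F.P K) 0, x ∈ domSet (F := F) 𝔠.lane.carrier.M₁ K k X := by
      intro x
      simp only [domSet, Set.mem_setOf_eq]
      refine ⟨b, hb, funext fun μ => ?_⟩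
      have hbv : (b μ).val = 0 := by
        have h1 := ZMod.val_lt (b μ)
        have h2 : nblkOf (SK F 𝔠 γ hγ hγ1 K) 𝔠.lane.carrier k = 1 := hN
        omega
      show ((coarsen k x) μ).val / 𝔠.M₁ = (b μ).val
      rw [hbv]
      exact Nat.div_eq_of_lt (lt_trans (ZMod.val_lt _) hcase)
    -- a second level-`(k+1)` site and a fine site above it
    have hS : 2 ≤ (F.P K).sitesPerDir (k + 1) := by
      show 2 ≤ 2 * (F.P K).L ^ ((F.P K).m + (F.P K).K - (k + 1))
      have : 1 ≤ (F.P K).L ^ ((F.P K).m + (F.P K).K - (k + 1)) := Nat.one_le_pow _ _ (by rw [hPL]; have := F.hL.2; omega)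
      omega
    haveI : Fact (1 < (F.P K).sitesPerDir (k + 1)) := ⟨by omega⟩
    set y' : Site (F.P K) (k + 1) := Function.update y ⟨0, by simp⟩ (y ⟨0, by simp⟩ + 1) with hy'
    have hne : y' ≠ y := by
      intro h
      have h0 := congrFun h ⟨0, by simp⟩
      rw [hy', Function.update_self] at h0
      exact one_ne_zero (add_eq_left.mp h0)
    obtain ⟨x', hx'⟩ := coarsen_surjective (P := F.P K) (k + 1) (show k + 1 ≤ (F.P K).m + (F.P K).K by show k + 1 ≤ F.m + K; omega) y'
    have hxb : x' ∈ blockSet K (k + 1) y := by rw [heq]; exact huniv x'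
    exact hne (hx'.symm.trans hxb)

/-- ★ **`hsep` FROM `L < M₁`**: for a rows record `q`, at every run `K` and every step `k + 1 ≤ K`, no retained domain `X ∈ newDomsRows q K k triv` has the point set of a level-`(1+k)`
block — the geometric letter of ✓`newLevelIsBirthRows_naturalChart` / the kernel-row door, discharged by print's «big blocks» being bigger than one averaging block.
[cite: Balaban1985UV3, (24) p.262, (39) p.266, (59) p.270] -/
theorem hsep_of_lt (q : ∀ K, AlphaInputsT3AC.PkgCoreRows F 𝔠 γ hγ hγ1 K) (hM : F.L < 𝔠.M₁) :
    ∀ (K k : ℕ), k + 1 ≤ K → ∀ X ∈ newDomsRows q K k (Hist.triv (F.P K) (k + 1)), ∀ y : Site (F.P K) (1 + k),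
      blockSet K (1 + k) y ≠ domSet (F := F) 𝔠.lane.carrier.M₁ K k X :=
  fun K k hk X _ y => blockSet_ne_domSet_of_lt hM K k hk X (by omega) y

end Separation

end Summit.QuantumFields.YangMills.Theorems.GlobalSlackKernelLeg

end
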